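import Mathlib
import HarnessLib

/-!
# `PerpetualPump.PumpTransfer` (stmt-NavierStokesRegularity-1837), line `Sketch`: stub `summation`

The pure real-analysis END GAME of the lead's skeleton `Cruxes/PumpTransfer/Lines/Sketch.lean` (v3, lead
prover prover-line-stmt-NavierStokesRegularity-1837-c1): the **Type-I functional bound of a certified
majorant family** (`stub_summation`, statement registered verbatim).

An abstract family `b i n t` (`i : Fin m`, `n : ℤ`; in the line these are Tao's band majorants, here
arbitrary reals) obeys on `[0,S)` the critical envelope `b ≤ K (1+ε₀)^{-n/2}`, is geometrically small above
the front (`b ≤ K (1+ε₀)^{-n/2} (2(1+ε₀))^{n₀+k+2-n}` for `t < T_{k+1}` and `n ≥ n₀+k+3`), and the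
checkpoints obey the Type-I clock `T_0 = 0`, `S − T_k ≤ c₂ (1+ε₀)^{-2k}`. Then
`Σ_{i,n} (1+ε₀)^{3n/2} b_{i,n}(t) ≤ M (S−t)^{-1/2}` on `[0,S)` (the sum in `ℝ≥0∞`, a `tsum` over
`Fin m × ℤ` of `ENNReal.ofReal`).

Proof. Fix `t ∈ [0,S)` and let `k` be the least index with `t < T_{k+1}` (it exists because
`T_{k+1} ≥ S − c₂(1+ε₀)^{-2(k+1)} → S > t`); minimality and `T_0 = 0` give `T_k ≤ t`, so the clock gives
`(1+ε₀)^{2k}(S−t) ≤ c₂`, i.e. `(1+ε₀)^k ≤ √c₂/√(S−t)`. With `a = 1+ε₀`, `N = n₀+k+2` and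
`ρ = max(a⁻¹, ½) < 1`, every weighted term is dominated by `K a^N ρ^{|n−N|}` (`summation_weighted_term_le`:
below the front `a^{3n/2} b ≤ K aⁿ = K a^N a^{n−N}`, above it `a^{3n/2} b ≤ K aⁿ (2a)^{N−n} = K a^N 2^{N−n}`),
a shifted two-sided geometric family with sum `K a^N Σ_j ρ^{|j|}`; summing over `Fin m` and using
`a^N = a^{n₀+2} a^k ≤ a^{n₀+2} √c₂/√(S−t)` gives the bound with
`M = m K a^{n₀+2} (Σ_{j∈ℤ} ρ^{|j|}) √c₂`.

The hypotheses `0 < S`, `0 < c₂`, `ε₀ ≤ 1` and the vanishing below `n₀` are part of the registered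
signature but are not needed for the bound (the dominating family is summable towards `n → −∞` anyway).

Mathlib only. [folklore]
-/

noncomputable section

-- the nested summit namespace is the tree's layout (D-0017)
set_option linter.dupNamespace false

namespace Summit.NavierStokesRegularity.NavierStokesRegularity.Theorems.PerpetualPumpPumpTransfer

open MeasureTheory Set Filter Topology
open scoped ENNReal

/-- Two-sided geometric families over `ℤ` are summable: `Σ_{j ∈ ℤ} ρ^{|j|} < ∞` for `0 ≤ ρ < 1`
(both halves are the geometric series). [folklore] -/
theorem summation_summable_pow_natAbs {ρ : ℝ} (h0 : 0 ≤ ρ) (h1 : ρ < 1) :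
    Summable fun j : ℤ => ρ ^ j.natAbs := by
  refine summable_int_iff_summable_nat_and_neg.2 ⟨?_, ?_⟩
  · simpa only [Int.natAbs_natCast] using summable_geometric_of_lt_one h0 h1
  · simpa only [Int.natAbs_neg, Int.natAbs_natCast] using summable_geometric_of_lt_one h0 h1

/-- The pointwise domination of one weighted term: if `x ≤ K a^{-n/2}` and, above the front `n > N`,
`x ≤ K a^{-n/2} (2a)^{N-n}`, then `a^{3n/2} x ≤ K a^N ρ^{|n-N|}` for any `ρ ≥ max(a⁻¹, ½)`
(below the front `a^{3n/2} x ≤ K aⁿ = K a^N a^{-(N-n)}`, above it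
`a^{3n/2} x ≤ K aⁿ (2a)^{N-n} = K a^N 2^{-(n-N)}`). [folklore] -/
theorem summation_weighted_term_le {a ρ K x : ℝ} (ha : 1 < a) (hρa : a⁻¹ ≤ ρ) (hρ2 : 1 / 2 ≤ ρ)
    (hK : 0 ≤ K) (N n : ℤ) (henv : x ≤ K * a ^ (-(n : ℝ) / 2))
    (htail : N < n → x ≤ K * a ^ (-(n : ℝ) / 2) * (2 * a) ^ (N - n)) :
    a ^ ((3 : ℝ) * n / 2) * x ≤ K * a ^ N * ρ ^ (n - N).natAbs := by
  have ha0 : 0 < a := lt_trans one_pos ha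
  have hw : 0 ≤ a ^ ((3 : ℝ) * n / 2) := (Real.rpow_pos_of_pos ha0 _).le
  have h1 : a ^ ((3 : ℝ) * n / 2) * (K * a ^ (-(n : ℝ) / 2)) = K * a ^ n := by
    rw [mul_left_comm, ← Real.rpow_add ha0,
      show (3 : ℝ) * n / 2 + -(n : ℝ) / 2 = ((n : ℤ) : ℝ) by ring, Real.rpow_intCast]
  have hKN : 0 ≤ K * a ^ N := mul_nonneg hK (zpow_nonneg ha0.le _)
  rcases le_or_gt n N with hnN | hNn
  · -- below the front: the critical envelope
    obtain ⟨j, hj⟩ : ∃ j : ℕ, N = n + j := ⟨(N - n).toNat, by omega⟩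
    have hnat : (n - N).natAbs = j := by omega
    have haρ : 1 ≤ a * ρ := by
      calc (1 : ℝ) = a * a⁻¹ := (mul_inv_cancel₀ ha0.ne').symm
        _ ≤ a * ρ := mul_le_mul_of_nonneg_left hρa ha0.le
    calc a ^ ((3 : ℝ) * n / 2) * x ≤ a ^ ((3 : ℝ) * n / 2) * (K * a ^ (-(n : ℝ) / 2)) :=
          mul_le_mul_of_nonneg_left henv hw
      _ = K * a ^ n * 1 := by rw [h1, mul_one]
      _ ≤ K * a ^ n * (a * ρ) ^ j :=
          mul_le_mul_of_nonneg_left (one_le_pow₀ haρ) (mul_nonneg hK (zpow_nonneg ha0.le _))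
      _ = K * a ^ N * ρ ^ (n - N).natAbs := by
          rw [hnat, hj, zpow_add₀ ha0.ne', zpow_natCast, mul_pow]; ring
  · -- above the front: the geometric tail
    obtain ⟨j, hj⟩ : ∃ j : ℕ, n = N + j := ⟨(n - N).toNat, by omega⟩
    have hnat : (n - N).natAbs = j := by omega
    have e1 : (2 * a) ^ (N - n) = ((2 * a) ^ j)⁻¹ := by
      rw [hj, show N - (N + (j : ℤ)) = -(j : ℤ) by ring, zpow_neg, zpow_natCast]
    have e2 : a ^ n = a ^ N * a ^ j := by rw [hj, zpow_add₀ ha0.ne', zpow_natCast]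
    have haj : a ^ j ≠ 0 := pow_ne_zero _ ha0.ne'
    calc a ^ ((3 : ℝ) * n / 2) * x
        ≤ a ^ ((3 : ℝ) * n / 2) * (K * a ^ (-(n : ℝ) / 2) * (2 * a) ^ (N - n)) :=
          mul_le_mul_of_nonneg_left (htail hNn) hw
      _ = K * a ^ n * (2 * a) ^ (N - n) := by rw [← mul_assoc, h1]
      _ = K * a ^ N * (1 / 2) ^ j := by
          rw [e1, e2, mul_pow, one_div, inv_pow, mul_inv]
          field_simp
      _ ≤ K * a ^ N * ρ ^ j :=
          mul_le_mul_of_nonneg_left (pow_le_pow_left₀ (by norm_num) hρ2 j) hKN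
      _ = K * a ^ N * ρ ^ (n - N).natAbs := by rw [hnat]

/-- **Stub `summation` (riskless, Mathlib-only): the Type-I functional bound of a certified majorant
family.** If quantities `b_{i,n}(t)` obey the critical envelope `b_{i,n}(t) ≤ K (1+ε₀)^{-n/2}` on `[0,S)`,
are geometrically small above the front (`b_{i,n}(t) ≤ K (1+ε₀)^{-n/2} (2(1+ε₀))^{n₀+k+2-n}` for
`t < T_{k+1}`, `n ≥ n₀+k+3`) and the checkpoints obey the Type-I clock `T_0 = 0`,
`S − T_k ≤ c₂ (1+ε₀)^{-2k}`, then `Σ_{i,n} (1+ε₀)^{3n/2} b_{i,n}(t) ≤ M (S−t)^{-1/2}` on `[0,S)`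
(in `ℝ≥0∞`): at time `t` pick the least `k` with `t < T_{k+1}` (it exists because `T_k → S`, and then
`T_k ≤ t`); the weighted family is dominated by `K (1+ε₀)^{n₀+k+2} ρ^{|n-(n₀+k+2)|}`,
`ρ = max((1+ε₀)^{-1}, ½)`, whose sum is `≲ (1+ε₀)^{k} ≤ (c₂/(S−t))^{1/2}`; here
`M = m K (1+ε₀)^{n₀+2} (Σ_{j∈ℤ} ρ^{|j|}) √c₂`. (The hypotheses `0 < S`, `0 < c₂`, `ε₀ ≤ 1` and the
vanishing below `n₀` belong to the registered signature and are not used.) [folklore] -/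
theorem stub_summation :
    ∀ {ε₀ : ℝ}, 0 < ε₀ → ε₀ ≤ 1 → ∀ {m : ℕ} (n₀ : ℤ) (S K c₂ : ℝ) (T : ℕ → ℝ)
      (b : Fin m → ℤ → ℝ → ℝ), 0 < S → 0 ≤ K → 0 < c₂ →
      T 0 = 0 → (∀ k : ℕ, S - T k ≤ c₂ / (1 + ε₀) ^ (2 * k)) →
      (∀ (i : Fin m) (n : ℤ) (t : ℝ), n < n₀ → b i n t ≤ 0) →
      (∀ (i : Fin m) (n : ℤ), ∀ t ∈ Ico 0 S, b i n t ≤ K * (1 + ε₀) ^ (-(n : ℝ) / 2)) →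
      (∀ k : ℕ, ∀ t ∈ Ico 0 (T (k + 1)), t < S → ∀ (i : Fin m) (n : ℤ), n₀ + k + 3 ≤ n →
        b i n t ≤ K * (1 + ε₀) ^ (-(n : ℝ) / 2) * (2 * (1 + ε₀)) ^ (n₀ + k + 2 - n)) →
      ∃ M : ℝ, ∀ t ∈ Ico 0 S,
        (∑' p : Fin m × ℤ, ENNReal.ofReal ((1 + ε₀) ^ ((3 : ℝ) * p.2 / 2) * b p.1 p.2 t)) ≤
          ENNReal.ofReal (M / Real.sqrt (S - t)) := by
  intro ε₀ hε₀ _ m n₀ S K c₂ T b _ hK _ hT0 hclock _ henv htail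
  have ha : 1 < 1 + ε₀ := by linarith
  have ha0 : 0 < 1 + ε₀ := by linarith
  -- the ratio `ρ = max((1+ε₀)⁻¹, ½)` and the two-sided geometric sum `G = Σ_{j ∈ ℤ} ρ^{|j|}`
  obtain ⟨ρ, hρa, hρ2, hρ0, hρ1⟩ :
      ∃ ρ : ℝ, (1 + ε₀)⁻¹ ≤ ρ ∧ 1 / 2 ≤ ρ ∧ 0 ≤ ρ ∧ ρ < 1 :=
    ⟨max (1 + ε₀)⁻¹ (1 / 2), le_max_left _ _, le_max_right _ _,
      le_trans (by norm_num) (le_max_right _ _), max_lt (inv_lt_one_of_one_lt₀ ha) (by norm_num)⟩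
  have hGs : Summable fun j : ℤ => ρ ^ j.natAbs := summation_summable_pow_natAbs hρ0 hρ1
  obtain ⟨G, hG⟩ : ∃ G : ℝ, HasSum (fun j : ℤ => ρ ^ j.natAbs) G := ⟨_, hGs.hasSum⟩
  have hG0 : 0 ≤ G := hG.nonneg fun j => pow_nonneg hρ0 _
  -- the constant
  obtain ⟨C, hC⟩ : ∃ C : ℝ, C = (m : ℝ) * K * (1 + ε₀) ^ (n₀ + 2) * G := ⟨_, rfl⟩
  have hC0 : 0 ≤ C := by
    rw [hC]
    exact mul_nonneg (mul_nonneg (mul_nonneg (Nat.cast_nonneg m) hK) (zpow_nonneg ha0.le _)) hG0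
  refine ⟨C * Real.sqrt c₂, fun t ht => ?_⟩
  have hSt : 0 < S - t := sub_pos.2 ht.2
  -- the step `k` of the clock at time `t`: `T k ≤ t < T (k+1)`,
  -- whence `(1+ε₀)^k ≤ √c₂ / √(S-t)`
  obtain ⟨k, hk, hak⟩ : ∃ k : ℕ, t < T (k + 1) ∧
      (1 + ε₀) ^ k ≤ Real.sqrt c₂ / Real.sqrt (S - t) := by
    classical
    have hex : ∃ k : ℕ, t < T (k + 1) := by
      obtain ⟨j, hj⟩ := pow_unbounded_of_one_lt (c₂ / (S - t)) ha
      refine ⟨j, ?_⟩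
      have h1 : c₂ / (1 + ε₀) ^ (2 * (j + 1)) < S - t := by
        rw [div_lt_iff₀ (pow_pos ha0 _)]
        calc c₂ < (1 + ε₀) ^ j * (S - t) := (div_lt_iff₀ hSt).1 hj
          _ ≤ (1 + ε₀) ^ (2 * (j + 1)) * (S - t) :=
            mul_le_mul_of_nonneg_right (pow_le_pow_right₀ ha.le (by omega)) hSt.le
          _ = (S - t) * (1 + ε₀) ^ (2 * (j + 1)) := mul_comm _ _
      have h2 := hclock (j + 1)
      linarith
    obtain ⟨k, hk, hmin⟩ :
        ∃ k : ℕ, t < T (k + 1) ∧ ∀ j : ℕ, j < k → ¬ t < T (j + 1) :=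
      ⟨Nat.find hex, Nat.find_spec hex, fun j hj => Nat.find_min hex hj⟩
    have hTk : T k ≤ t := by
      rcases k with _ | j
      · rw [hT0]; exact ht.1
      · exact not_lt.1 (hmin j (lt_add_one j))
    have h2 : (1 + ε₀) ^ (2 * k) * (S - t) ≤ c₂ :=
      calc (1 + ε₀) ^ (2 * k) * (S - t) ≤ (1 + ε₀) ^ (2 * k) * (S - T k) :=
            mul_le_mul_of_nonneg_left (by linarith) (pow_nonneg ha0.le _)
        _ = (S - T k) * (1 + ε₀) ^ (2 * k) := mul_comm _ _
        _ ≤ c₂ := (le_div_iff₀ (pow_pos ha0 _)).1 (hclock k)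
    refine ⟨k, hk, ?_⟩
    rw [le_div_iff₀ (Real.sqrt_pos.2 hSt)]
    refine Real.le_sqrt_of_sq_le ?_
    rw [mul_pow, Real.sq_sqrt hSt.le, ← pow_mul, mul_comm k 2]
    exact h2
  -- the dominating family at time `t`: `g n = K (1+ε₀)^N ρ^{|n-N|}`, `N = n₀ + k + 2`
  have hpt : ∀ (i : Fin m) (n : ℤ), (1 + ε₀) ^ ((3 : ℝ) * n / 2) * b i n t ≤
      K * (1 + ε₀) ^ (n₀ + k + 2) * ρ ^ (n - (n₀ + k + 2)).natAbs := fun i n =>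
    summation_weighted_term_le ha hρa hρ2 hK (n₀ + k + 2) n (henv i n t ht)
      fun hNn => htail k t ⟨ht.1, hk⟩ ht.2 i n (by omega)
  have hg0 : ∀ n : ℤ,
      0 ≤ K * (1 + ε₀) ^ (n₀ + k + 2) * ρ ^ (n - (n₀ + k + 2)).natAbs := fun n =>
    mul_nonneg (mul_nonneg hK (zpow_nonneg ha0.le _)) (pow_nonneg hρ0 _)
  have hgs : Summable
      fun n : ℤ => K * (1 + ε₀) ^ (n₀ + k + 2) * ρ ^ (n - (n₀ + k + 2)).natAbs :=
    ((Equiv.subRight (n₀ + k + 2)).summable_iff.2 hGs).mul_left (K * (1 + ε₀) ^ (n₀ + k + 2))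
  have hgsum : ∑' n : ℤ, K * (1 + ε₀) ^ (n₀ + k + 2) * ρ ^ (n - (n₀ + k + 2)).natAbs =
      K * (1 + ε₀) ^ (n₀ + k + 2) * G := by
    rw [tsum_mul_left, ← hG.tsum_eq]
    congr 1
    exact (Equiv.subRight (n₀ + (k : ℤ) + 2)).tsum_eq (fun j : ℤ => ρ ^ j.natAbs)
  -- the final real inequality
  have hfinal : (m : ℝ) * (K * (1 + ε₀) ^ (n₀ + k + 2) * G) ≤
      C * Real.sqrt c₂ / Real.sqrt (S - t) := by
    have e : (1 + ε₀) ^ (n₀ + (k : ℤ) + 2) = (1 + ε₀) ^ (n₀ + 2) * (1 + ε₀) ^ k := by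
      rw [show n₀ + (k : ℤ) + 2 = n₀ + 2 + k by ring, zpow_add₀ ha0.ne', zpow_natCast]
    calc (m : ℝ) * (K * (1 + ε₀) ^ (n₀ + k + 2) * G)
        = C * (1 + ε₀) ^ k := by rw [e, hC]; ring
      _ ≤ C * (Real.sqrt c₂ / Real.sqrt (S - t)) := mul_le_mul_of_nonneg_left hak hC0
      _ = C * Real.sqrt c₂ / Real.sqrt (S - t) := by ring
  -- summation in `ℝ≥0∞`
  calc ∑' p : Fin m × ℤ, ENNReal.ofReal ((1 + ε₀) ^ ((3 : ℝ) * p.2 / 2) * b p.1 p.2 t)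
      ≤ ∑' p : Fin m × ℤ,
          ENNReal.ofReal (K * (1 + ε₀) ^ (n₀ + k + 2) * ρ ^ (p.2 - (n₀ + k + 2)).natAbs) :=
        ENNReal.tsum_le_tsum fun p => ENNReal.ofReal_le_ofReal (hpt p.1 p.2)
    _ = ∑' _i : Fin m, ∑' n : ℤ,
          ENNReal.ofReal (K * (1 + ε₀) ^ (n₀ + k + 2) * ρ ^ (n - (n₀ + k + 2)).natAbs) :=
        ENNReal.tsum_prod (f := fun (_ : Fin m) (n : ℤ) =>
          ENNReal.ofReal (K * (1 + ε₀) ^ (n₀ + k + 2) * ρ ^ (n - (n₀ + k + 2)).natAbs))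
    _ = ∑' _i : Fin m, ENNReal.ofReal (K * (1 + ε₀) ^ (n₀ + k + 2) * G) := by
        refine tsum_congr fun _ => ?_
        rw [← hgsum]
        exact (ENNReal.ofReal_tsum_of_nonneg hg0 hgs).symm
    _ = (m : ℝ≥0∞) * ENNReal.ofReal (K * (1 + ε₀) ^ (n₀ + k + 2) * G) := by
        rw [tsum_fintype, Finset.sum_const, Finset.card_univ, Fintype.card_fin, nsmul_eq_mul]
    _ = ENNReal.ofReal ((m : ℝ) * (K * (1 + ε₀) ^ (n₀ + k + 2) * G)) := by
        rw [ENNReal.ofReal_mul (Nat.cast_nonneg m), ENNReal.ofReal_natCast]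
    _ ≤ ENNReal.ofReal (C * Real.sqrt c₂ / Real.sqrt (S - t)) := ENNReal.ofReal_le_ofReal hfinal

end Summit.NavierStokesRegularity.NavierStokesRegularity.Theorems.PerpetualPumpPumpTransfer
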